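import Summits.CriticalPhenomena.PercolationContinuityZ3.Theorems.PercNearOneGluingNoHeavyLowerTailThreePointCPIClusterSwap
import Summits.CriticalPhenomena.PercolationContinuityZ3.Theorems.PercNearOneGluingNoHeavyLowerTailThreePointCPIReimer
import HarnessLib

/-!
# Exact Reimer for `(Y, D)` and the reformulation of the 3-point CPI₂ inside `D` (cluster-swap counting)

Crux `stmt-CriticalPhenomena-4575`, route `PercNearOneGluingNoHeavy`, 3-point CPI₂ fibre line (facecert gen 28; memo
`prim-l12/prim-facecert/FINDING-gen28-CLUSTER-SWAP.md`).  Counting consequences of the cluster flip `μ_b`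
(`…ThreePointCPIClusterSwap`): notation as there (`Q_t` closed clusters, `U_s(z)` = open reach of `s` avoiding `V(Q_b(z))`,
`D = {s ∉ Q_b}`, `J = {s ↔ b open}`, `Y = {c ↔ {s,b} open}`, `A₃ = #{¬J ∧ Y}`, `B₃ = #{¬J(z) ∧ Y(z̄)} = #{D ∧ Y}`).

* `card_D_creach_eq_card_D_ureach` — `#{z ∈ D : c ∈ Q_s(z)} = #{z ∈ D : c ∈ U_s(z)}` (`μ_b` is a bijection of `D` swapping
  the two events; stated for any ordered pair of terminals).
* `card_A3_eq_card_D_creach`, `card_D_creach_or`, `card_A3_eq_card_D_ureach_add` — **EXACT REIMER**: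
  `A₃ = #{D ∧ c∈Q_s} + #{D ∧ c∈Q_b} = #{D ∧ c∈U_s} + #{D ∧ c∈U_b}`.  Since `Y □ D ⟺ c ∈ U_s ∪ U_b` (facecert gen-26 memo
  §0(6)), Reimer's inequality `#(Y □ D) ≤ A₃` (`…ThreePointCPIReimer.card_box_le`) holds with defect EXACTLY
  `#{D ∧ c ∈ U_s ∩ U_b}`.
* `two_mul_A3_add_card_pockets`, `threePoint_cpi_two_of_pockets` — **CPI₂ INSIDE `D`**: with
  `m(z) = [c∈Q_s]+[c∈Q_b]+[c∈U_s]+[c∈U_b] ∈ {0,1,2}`,  `2A₃ + #{D, Y, m=0} = B₃ + #{D, m=2} + #{D, ¬Y, c∈Q_s∪Q_b}`; hence the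
  3-point CPI₂ `B₃ ≤ 2A₃` is EQUIVALENT to the pocket bound `#{D, c∈C∖(Q∪U)} ≤ #{D, m=2} + #{D, c∈Q∖C}`.  Compared with
  `(★★)` (`…ThreePointCPIReimer`, `…ThreePointCPIPuncturedCount`) the right-hand side carries the extra room
  `#{D, c ∈ U_s ∩ U_b}` and the `¬J` parts.  Census (facecert gen 28, engines `work/c/acc.c`): identity and pocket bound
  verified on all multigraphs with `n ≤ 6`, `m ≤ 7` and on 2·10⁴ random multigraphs with `n ≤ 11`, `m ≤ 20`.
-/

namespace Summit.CriticalPhenomena.PercolationContinuityZ3.Theorems.ThreePointCPIClusterSwap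

open Finset Literature.Probability.Percolation

variable {V α : Type*}

/-! ### Counting: the exact Reimer identity and the reformulation of CPI₂ inside `D` -/

section Counting

variable [Fintype α] [DecidableEq α] (ends : α → Sym2 V) (s b c : V)

open Classical in
/-- **`μ_b` as a bijection of `D`.** `#{z ∈ D : c ∈ Q_s(z)} = #{z ∈ D : c ∈ U_s(z)}` (`D = {s ∉ Q_b}`): the cluster flip
`μ_b` maps the first set onto the second (`ureach_clusterFlip_iff`) and is an involution. Stated for an arbitrary ordered
pair of terminals `(s, b)`. [this work] -/
theorem card_D_creach_eq_card_D_ureach :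
    (univ.filter fun z : α → Bool => ¬ CReach ends z b s ∧ CReach ends z s c).card =
      (univ.filter fun z : α → Bool => ¬ CReach ends z b s ∧ UReach ends s b z c).card := by
  refine Finset.card_bij' (fun z _ => clusterFlip ends b z) (fun z _ => clusterFlip ends b z) ?_ ?_ ?_ ?_
  · intro z hz
    simp only [mem_filter, mem_univ, true_and] at hz ⊢
    exact ⟨(not_creach_clusterFlip_iff ends s b z).2 hz.1, (ureach_clusterFlip_iff ends s b z hz.1 c).2 hz.2⟩
  · intro z hz
    simp only [mem_filter, mem_univ, true_and] at hz ⊢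
    refine ⟨(not_creach_clusterFlip_iff ends s b z).2 hz.1, ?_⟩
    exact (creach_clusterFlip_iff_ureach ends s b z hz.1 c).2 hz.2
  · intro z _; exact clusterFlip_clusterFlip ends b z
  · intro z _; exact clusterFlip_clusterFlip ends b z

open Classical in
/-- **`A₃` inside `D` (complement bijection).** `A₃ = #{z : s ↮ b open, c ↔ {s,b} open}` equals
`#{z ∈ D : c ∈ Q_s(z) ∨ c ∈ Q_b(z)}` (`z ↦ z̄`). [this work] -/
theorem card_A3_eq_card_D_creach :
    (univ.filter fun z : α → Bool =>
        ¬ (openGraph (labelledOpen ends z)).Reachable s b ∧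
        ((openGraph (labelledOpen ends z)).Reachable c s ∨
          (openGraph (labelledOpen ends z)).Reachable c b)).card =
    (univ.filter fun z : α → Bool => ¬ CReach ends z b s ∧ (CReach ends z s c ∨ CReach ends z b c)).card := by
  have h := ThreePointCPIReimer.card_filter_flip
    (P := fun z : α → Bool => ¬ CReach ends z b s ∧ (CReach ends z s c ∨ CReach ends z b c))
  rw [← h]
  refine congrArg Finset.card (Finset.filter_congr fun z _ => ?_)
  have e : (fun a => !(fun a => !z a) a) = z := by funext a; simp
  simp only [CReach, e]
  constructor
  · rintro ⟨hJ, hY⟩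
    exact ⟨fun h => hJ h.symm, hY.imp (fun h => h.symm) (fun h => h.symm)⟩
  · rintro ⟨hJ, hY⟩
    exact ⟨fun h => hJ h.symm, hY.imp (fun h => h.symm) (fun h => h.symm)⟩

open Classical in
/-- Inside `D` the events `c ∈ Q_s` and `c ∈ Q_b` are disjoint, so
`#{D ∧ (c∈Q_s ∨ c∈Q_b)} = #{D ∧ c∈Q_s} + #{D ∧ c∈Q_b}`. [this work] -/
theorem card_D_creach_or :
    (univ.filter fun z : α → Bool => ¬ CReach ends z b s ∧ (CReach ends z s c ∨ CReach ends z b c)).card =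
      (univ.filter fun z : α → Bool => ¬ CReach ends z b s ∧ CReach ends z s c).card +
        (univ.filter fun z : α → Bool => ¬ CReach ends z b s ∧ CReach ends z b c).card := by
  rw [← card_union_of_disjoint]
  · refine congrArg Finset.card ?_
    ext z
    simp only [mem_filter, mem_univ, true_and, mem_union]
    tauto
  · rw [Finset.disjoint_left]
    intro z h1 h2
    simp only [mem_filter, mem_univ, true_and] at h1 h2
    exact h1.1 (h2.2.trans h1.2.symm)

open Classical in
/-- **Exact Reimer for the 3-point events.** `A₃ = #{z ∈ D : c ∈ U_s(z)} + #{z ∈ D : c ∈ U_b(z)}`, where `U_s(z)` is the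
open reach of `s` avoiding the closed cluster of `b`.  (With the characterisation `Y □ D ⟺ c ∈ U_s ∪ U_b` of the facecert
gen-26 memo this says that Reimer's inequality `#(Y □ D) ≤ A₃` has defect exactly `#{D, c ∈ U_s ∩ U_b}`.) [this work] -/
theorem card_A3_eq_card_D_ureach_add :
    (univ.filter fun z : α → Bool =>
        ¬ (openGraph (labelledOpen ends z)).Reachable s b ∧
        ((openGraph (labelledOpen ends z)).Reachable c s ∨
          (openGraph (labelledOpen ends z)).Reachable c b)).card =
    (univ.filter fun z : α → Bool => ¬ CReach ends z b s ∧ UReach ends s b z c).card +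
      (univ.filter fun z : α → Bool => ¬ CReach ends z b s ∧ UReach ends b s z c).card := by
  rw [card_A3_eq_card_D_creach, card_D_creach_or, card_D_creach_eq_card_D_ureach]
  congr 1
  -- the `b`-term: swap the roles of the terminals
  have e1 : (univ.filter fun z : α → Bool => ¬ CReach ends z b s ∧ CReach ends z b c) =
      (univ.filter fun z : α → Bool => ¬ CReach ends z s b ∧ CReach ends z b c) := by
    refine Finset.filter_congr fun z _ => ?_
    exact and_congr_left' ⟨fun h h' => h h'.symm, fun h h' => h h'.symm⟩
  have e2 : (univ.filter fun z : α → Bool => ¬ CReach ends z b s ∧ UReach ends b s z c) =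
      (univ.filter fun z : α → Bool => ¬ CReach ends z s b ∧ UReach ends b s z c) := by
    refine Finset.filter_congr fun z _ => ?_
    exact and_congr_left' ⟨fun h h' => h h'.symm, fun h h' => h h'.symm⟩
  rw [e1, e2, card_D_creach_eq_card_D_ureach ends b s c]

/-- Pointwise bookkeeping behind `two_mul_A3_add_card_pockets`: for indicators `D, Y, qs, qb, us, ub` with
`D → ¬(qs ∧ qb)`, `D → us → ¬qb`, `D → ub → ¬qs`, `us → Y`, `ub → Y` one has
`[D∧qs]+[D∧qb]+[D∧us]+[D∧ub]+[D∧Y∧m=0] = [D∧Y]+[D∧m=2]+[D∧¬Y∧(qs∨qb)]`. [this work] -/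
theorem cells_pointwise (D Y qs qb us ub : Prop) [Decidable D] [Decidable Y] [Decidable qs] [Decidable qb]
    [Decidable us] [Decidable ub]
    (h1 : D → qs → ¬ qb) (h2 : D → us → ¬ qb) (h3 : D → ub → ¬ qs) (h4 : us → Y) (h5 : ub → Y) :
    (if D ∧ qs then 1 else 0) + (if D ∧ qb then 1 else 0) + (if D ∧ us then 1 else 0) +
        (if D ∧ ub then 1 else 0) + (if D ∧ Y ∧ ¬ qs ∧ ¬ qb ∧ ¬ us ∧ ¬ ub then 1 else 0) =
      (if D ∧ Y then 1 else 0) +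
        (if D ∧ ((qs ∧ us) ∨ (qb ∧ ub) ∨ (us ∧ ub)) then 1 else 0) +
        (if D ∧ ¬ Y ∧ (qs ∨ qb) then 1 else 0) := by
  by_cases hD : D <;> by_cases hY : Y <;> by_cases hqs : qs <;> by_cases hqb : qb <;>
    by_cases hus : us <;> by_cases hub : ub <;> simp_all

open Classical in
/-- **Bookkeeping identity (CPI₂ inside `D`).** With `Q_t` the closed clusters, `U_s` (`U_b`) the open reach of `s` (`b`)
avoiding `V(Q_b)` (`V(Q_s)`), `D = {s ∉ Q_b}`, `Y = {c ↔ {s,b}}`: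
`2·A₃ + #{D, Y, c ∉ Q_s∪Q_b∪U_s∪U_b} = B₃ + #{D, (c∈Q_s∩U_s) ∨ (c∈Q_b∩U_b) ∨ (c∈U_s∩U_b)} + #{D, ¬Y, c∈Q_s∪Q_b}`,
where `A₃ = #{s ↮ b open, c ↔ {s,b} open}` and `B₃ = #{s ↮ b open, c ↔ {s,b} closed}` are the 3-point counts of
`…ThreePointCPISigma`. [this work] -/
theorem two_mul_A3_add_card_pockets :
    2 * (univ.filter fun z : α → Bool =>
        ¬ (openGraph (labelledOpen ends z)).Reachable s b ∧
        ((openGraph (labelledOpen ends z)).Reachable c s ∨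
          (openGraph (labelledOpen ends z)).Reachable c b)).card +
      (univ.filter fun z : α → Bool => ¬ CReach ends z b s ∧
        ((openGraph (labelledOpen ends z)).Reachable c s ∨ (openGraph (labelledOpen ends z)).Reachable c b) ∧
        ¬ CReach ends z s c ∧ ¬ CReach ends z b c ∧ ¬ UReach ends s b z c ∧ ¬ UReach ends b s z c).card =
    (univ.filter fun z : α → Bool =>
        ¬ (openGraph (labelledOpen ends z)).Reachable s b ∧
        ((openGraph (labelledOpen ends fun a => !z a)).Reachable c s ∨
          (openGraph (labelledOpen ends fun a => !z a)).Reachable c b)).card +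
      (univ.filter fun z : α → Bool => ¬ CReach ends z b s ∧
        ((CReach ends z s c ∧ UReach ends s b z c) ∨ (CReach ends z b c ∧ UReach ends b s z c) ∨
          (UReach ends s b z c ∧ UReach ends b s z c))).card +
      (univ.filter fun z : α → Bool => ¬ CReach ends z b s ∧
        ¬ ((openGraph (labelledOpen ends z)).Reachable c s ∨ (openGraph (labelledOpen ends z)).Reachable c b) ∧
        (CReach ends z s c ∨ CReach ends z b c)).card := by
  -- 2A₃ = (#{D∧Q_s} + #{D∧Q_b}) + (#{D∧U_s} + #{D∧U_b}); B₃ = #{D ∧ Y}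
  rw [two_mul]
  nth_rw 1 [card_A3_eq_card_D_creach ends s b c]
  rw [card_D_creach_or ends s b c, card_A3_eq_card_D_ureach_add ends s b c, ThreePointCPISigma_B_eq]
  · simp only [Finset.card_filter]
    rw [← Finset.sum_add_distrib, ← Finset.sum_add_distrib, ← Finset.sum_add_distrib, ← Finset.sum_add_distrib,
      ← Finset.sum_add_distrib, ← Finset.sum_add_distrib]
    refine Finset.sum_congr rfl fun z _ => ?_
    have hDsym : ∀ {x y : V}, CReach ends z x y → CReach ends z y x := fun h => h.symm
    have key := cells_pointwise (¬ CReach ends z b s)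
      ((openGraph (labelledOpen ends z)).Reachable c s ∨ (openGraph (labelledOpen ends z)).Reachable c b)
      (CReach ends z s c) (CReach ends z b c) (UReach ends s b z c) (UReach ends b s z c)
      (fun hD hqs hqb => hD (hqb.trans hqs.symm))
      (fun hD hus hqb => not_creach_of_ureach ends s b z hD hus hqb)
      (fun hD hub hqs => not_creach_of_ureach ends b s z (fun h => hD (hDsym h)) hub hqs)
      (fun hus => Or.inl (reachable_of_ureach ends s b z hus).symm)
      (fun hub => Or.inr (reachable_of_ureach ends b s z hub).symm)
    simpa only [add_assoc] using key
  where
  /-- `B₃ = #{D ∧ Y}` in the present spelling (`…ThreePointCPIReimer.threePoint_B_eq_card_DY`). -/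
  ThreePointCPISigma_B_eq :
      (univ.filter fun z : α → Bool =>
        ¬ (openGraph (labelledOpen ends z)).Reachable s b ∧
        ((openGraph (labelledOpen ends fun a => !z a)).Reachable c s ∨
          (openGraph (labelledOpen ends fun a => !z a)).Reachable c b)).card =
      (univ.filter fun z : α → Bool => ¬ CReach ends z b s ∧
        ((openGraph (labelledOpen ends z)).Reachable c s ∨
          (openGraph (labelledOpen ends z)).Reachable c b)).card := by
    classical
    rw [ThreePointCPIReimer.threePoint_B_eq_card_DY ends s b c]
    refine congrArg Finset.card (Finset.filter_congr fun z _ => ?_)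
    simp only [CReach]
    exact and_congr_left' ⟨fun h h' => h h'.symm, fun h h' => h h'.symm⟩

open Classical in
/-- **CPI₂ from the pocket bound.** For every finite multigraph and all `s, b, c`: if the "pocket" configurations
`P = {z ∈ D : c ↔ {s,b} open, c ∉ Q_s ∪ Q_b ∪ U_s ∪ U_b}` are at most the configurations with a spare attachment,
`#P ≤ #{z ∈ D : (c ∈ Q_s∩U_s) ∨ (c ∈ Q_b∩U_b) ∨ (c ∈ U_s∩U_b)} + #{z ∈ D : c ↮ {s,b} open, c ∈ Q_s ∪ Q_b}`,
then the 3-point CPI₂ `B₃ ≤ 2A₃` of `…ThreePointCPISigma` holds (and conversely, by `two_mul_A3_add_card_pockets`).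
[this work] -/
theorem threePoint_cpi_two_of_pockets
    (hP : (univ.filter fun z : α → Bool => ¬ CReach ends z b s ∧
        ((openGraph (labelledOpen ends z)).Reachable c s ∨ (openGraph (labelledOpen ends z)).Reachable c b) ∧
        ¬ CReach ends z s c ∧ ¬ CReach ends z b c ∧ ¬ UReach ends s b z c ∧ ¬ UReach ends b s z c).card ≤
      (univ.filter fun z : α → Bool => ¬ CReach ends z b s ∧
        ((CReach ends z s c ∧ UReach ends s b z c) ∨ (CReach ends z b c ∧ UReach ends b s z c) ∨
          (UReach ends s b z c ∧ UReach ends b s z c))).card +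
      (univ.filter fun z : α → Bool => ¬ CReach ends z b s ∧
        ¬ ((openGraph (labelledOpen ends z)).Reachable c s ∨ (openGraph (labelledOpen ends z)).Reachable c b) ∧
        (CReach ends z s c ∨ CReach ends z b c)).card) :
    (univ.filter fun z : α → Bool =>
        ¬ (openGraph (labelledOpen ends z)).Reachable s b ∧
        ((openGraph (labelledOpen ends fun a => !z a)).Reachable c s ∨
          (openGraph (labelledOpen ends fun a => !z a)).Reachable c b)).card ≤
      2 * (univ.filter fun z : α → Bool =>
        ¬ (openGraph (labelledOpen ends z)).Reachable s b ∧
        ((openGraph (labelledOpen ends z)).Reachable c s ∨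
          (openGraph (labelledOpen ends z)).Reachable c b)).card := by
  have h := two_mul_A3_add_card_pockets ends s b c
  omega

end Counting

end Summit.CriticalPhenomena.PercolationContinuityZ3.Theorems.ThreePointCPIClusterSwap
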